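import Literature.AlgebraicGeometry.Motives.HodgeLieExteriorPowerDerivation
import Literature.AlgebraicGeometry.Motives.HodgeStructureExteriorPowerOverField
import HarnessLib

/-!
# Weil classes cut down the Hodge Lie algebra: an operator whose derivation scales the Weil lines `⋀ᵈ V_{ℂ,σ}` by non-zero
# scalars is not in `𝔥(H)` (the mechanism of Moonen–Zarhin 1999 Thm. 0.1 (4)(a): `Hg(E × T) ≠ Hg(E) × Hg(T)` when `k ⊂ End⁰T`)

Family `hodge`, layer `Literature/AlgebraicGeometry/Motives`; THEOREMS ONLY (no definition, no named fact).  Written for the cell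
`pub-hodgecm2` (COR-CM), seat `b27` gen 48 (count-neutral Mumford–Tate-rank ladder; the same-field cell `E × T`).  Sequel of
`Motives/HodgeLieExteriorPowerDerivation` (`𝔥(H)` kills the Hodge classes of `⋀ᵈ H` under `derivationExteriorPower`) and of the tree's
`Motives/HodgeStructureExteriorPowerOverField` (cell `lit-hodgefound`: Weil's `⋀ᵈ_E V ⊂ ⋀ᵈ V`, `EndAction.weilPower`, its complexification
`⊕_σ ⋀ᵈ V_{ℂ,σ}`, its dimension `[E:ℚ]·C(dim_E V, d)`, and «Weil type ⟹ Weil classes are Hodge classes»,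
`weilPower_le_hodgeClasses_of_forall_two_mul_multiplicity_eq`).

SETTING.  `H` an effective `ℚ`-Hodge structure of weight `1` on `V`, `A : EndAction H E` an action of a QUADRATIC number field `E` by
Hodge endomorphisms, OF WEIL TYPE: `2 · n_σ = d` for both embeddings `σ : E → ℂ`, where `d = dim_ℂ V_{ℂ,σ} = dim_ℚ V / 2` and
`n_σ = dim V^{1,0}_σ` (`A.multiplicity σ`).  Then Weil's plane `W = ⋀ᵈ_E V ⊂ ⋀ᵈ V` (`A.weilPower d`, `dim_ℚ W = 2`) consists of Hodge
classes of type `(d/2, d/2)`, and `W ⊗ ℂ = ⋀ᵈ V_{ℂ,σ} ⊕ ⋀ᵈ V_{ℂ,σ̄}` (two lines).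

RESULTS.
* §1 (linear algebra over a field) `range_exteriorPower_map_subtype_le_eigenspace_of_eigenbasis` — if a `d`-dimensional subspace `N`
  contains `d` independent eigenvectors `v_i` of `Y` (`Y v_i = c_i v_i`), then the LINE `⋀ᵈ N ⊂ ⋀ᵈ M` lies in the eigenspace of the
  derivation `D_Y` for the eigenvalue `Σ c_i` (`D_Y (v₁ ∧ ⋯ ∧ v_d) = (Σ c_i) v₁ ∧ ⋯ ∧ v_d`, and `v₁ ∧ ⋯ ∧ v_d ≠ 0` spans `⋀ᵈ N`).
* §2 `eq_zero_of_mem_weilPower_of_derivationExteriorPower_eq_zero` — if the derivation `D_{X_ℂ}` of a rational operator `X` has each Weil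
  line `⋀ᵈ V_{ℂ,σ}` inside an eigenspace with NON-ZERO eigenvalue `c_σ`, then `D_X` is injective on `⋀ᵈ_E V` (base change
  `θ₀ : ℂ ⊗ ⋀ᵈ_ℚ V ≃ ⋀ᵈ_ℂ V_ℂ` intertwines `D_X` and `D_{X_ℂ}`; eigenspaces are independent, so `ker D_{X_ℂ} ∩ (⋀ᵈ_E V)_ℂ = 0`).
* §3 **`not_mem_hodgeLie_of_weilType_of_derivation_eigenvalues`** — under the Weil-type hypothesis such an `X` is NOT in `𝔥(H)`: a
  non-zero Weil class `w` is a Hodge class of `⋀ᵈ H` with `D_X w ≠ 0`, contradicting `derivationExteriorPower_apply_eq_zero_of_mem_hodgeLie`.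
  («In case (a) the Weil classes are really needed»: they are Hodge classes NOT fixed by `Hg(E) × Hg(T)`, so `Hg(E × T)` is smaller.)
The consumer (`Motives/HodgeLieWeilClassesProduct`) takes `H = H¹(T) ⊕ H¹(E)` with the diagonal action of `k = End⁰E ⊂ End⁰T` and
`X = 0 ⊕ χ^*`: the line `⋀ᵈ V_{ℂ,σ}` is scaled by `σ(χ) ≠ 0`, so `0 ⊕ χ^* ∉ 𝔥(H¹(T × E))` although `χ^* ∈ 𝔥(H¹E)` — the corner of
`𝔥(H¹E)` is missing and `dim Hg(T × E) < dim Hg(T) + dim Hg(E)`.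

## References
* [MoonenZarhin1999LowDim] B. Moonen, Yu. G. Zarhin, *Hodge classes on abelian varieties of low dimension*, Math. Ann. 315 (1999), Thm. 0.1 (4)
  case (a), Thm. (0.2) (1) («the Weil classes are really needed»), §3 (3.1), Prop. (3.8) [corpus: paper:arxiv-math_9901113 pp. 1–2, 6–7].
  [cite: MoonenZarhin1999LowDim, Thm. 0.1 (4) and §3 (3.1)]
* [Deligne1982HodgeCycles] P. Deligne, LNM 900 (1982), I §3.1, Prop. 3.4; §4 Lemma 4.3, Prop. 4.4 (Weil classes `⋀ᵈ_E H¹`).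
  [cite: Deligne1982HodgeCycles, §4 Prop. 4.4]
* [vanGeemen1994HodgeAV] B. van Geemen, *An introduction to the Hodge conjecture for abelian varieties*, LNM 1594 (1994), 4.9–4.10, 5.2.
  [cite: vanGeemen1994HodgeAV, 4.9–4.10]
-/

noncomputable section

open scoped TensorProduct

namespace Literature.AlgebraicGeometry.Motives

namespace HodgeStructure

universe u

/-! ## §1 A line of top wedges of eigenvectors lies in an eigenspace of the derivation -/

section Line

variable {K : Type*} [Field K] {M : Type*} [AddCommGroup M] [Module K M]

/-- **`⋀ᵈ N` lies in the `(Σ cᵢ)`-eigenspace of `D_Y` when the `d`-dimensional `N` has a basis of `Y`-eigenvectors `vᵢ` (`Y vᵢ = cᵢ vᵢ`).**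
The top wedge `v₁ ∧ ⋯ ∧ v_d` (in the increasing enumeration of Mathlib's `ιMulti_family`) is non-zero (`ιMulti_family_linearIndependent_field`),
lies in `⋀ᵈ N = range ⋀ᵈ(N ↪ M)`, which is a line (`dim = C(d, d) = 1`, `finrank_range_exteriorPower_map_subtype`), and is a `D_Y`-eigenvector
for `Σ cᵢ` (`derivationExteriorPower_ιMulti_of_eigen`). [cite: Deligne1982HodgeCycles, §4 Prop. 4.4] [folklore] -/
theorem range_exteriorPower_map_subtype_le_eigenspace_of_eigenbasis (N : Submodule K M) [Module.Finite K N] {d : ℕ}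
    (hN : Module.finrank K N = d) (v : Fin d → M) (hv : LinearIndependent K v) (hvN : ∀ i, v i ∈ N) (Y : Module.End K M)
    (c : Fin d → K) (hY : ∀ i, Y (v i) = c i • v i) :
    LinearMap.range (exteriorPower.map d N.subtype) ≤ Module.End.eigenspace (derivationExteriorPower Y d) (∑ i, c i) := by
  classical
  -- the top wedge, in Mathlib's increasing enumeration of `univ ⊆ Fin d`
  let s₀ : Set.powersetCard (Fin d) d := ⟨Finset.univ, by simp⟩
  set g : Fin d → Fin d := fun i => (Set.powersetCard.ofFinEmbEquiv.symm s₀) i with hg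
  have hginj : Function.Injective g := fun i j h => (Set.powersetCard.ofFinEmbEquiv.symm s₀).injective h
  have hgbij : Function.Bijective g := Finite.injective_iff_bijective.1 hginj
  set w : ⋀[K]^d M := exteriorPower.ιMulti K d (v ∘ g) with hw
  have hw' : w = exteriorPower.ιMulti_family K d v s₀ := rfl
  -- `w ≠ 0`
  have hw0 : w ≠ 0 := by
    rw [hw']
    exact (exteriorPower.ιMulti_family_linearIndependent_field (n := d) hv).ne_zero s₀
  -- `w ∈ ⋀ᵈ N`
  have hwN : w ∈ LinearMap.range (exteriorPower.map d N.subtype) := by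
    refine ⟨exteriorPower.ιMulti K d (fun i => (⟨v (g i), hvN (g i)⟩ : N)), ?_⟩
    rw [exteriorPower.map_apply_ιMulti]
    rfl
  -- `D_Y w = (Σ c) w`
  have hDw : derivationExteriorPower Y d w = (∑ i, c i) • w := by
    rw [hw, derivationExteriorPower_ιMulti_of_eigen Y d (v ∘ g) (c ∘ g) (fun i => hY (g i))]
    congr 1
    exact Equiv.sum_comp (Equiv.ofBijective g hgbij) c
  -- `⋀ᵈ N` is the line `K w`
  have h1 : Module.finrank K (LinearMap.range (exteriorPower.map d N.subtype)) = 1 := by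
    rw [finrank_range_exteriorPower_map_subtype N d, hN, Nat.choose_self]
  have hline : LinearMap.range (exteriorPower.map d N.subtype) = K ∙ w := by
    refine (Submodule.eq_of_le_of_finrank_eq ((Submodule.span_singleton_le_iff_mem _ _).2 hwN) ?_).symm
    rw [finrank_span_singleton hw0, h1]
  rw [hline, Submodule.span_singleton_le_iff_mem, Module.End.mem_eigenspace_iff, hDw]

end Line

/-! ## §2 `D_X` is injective on the Weil classes when it scales the Weil lines by non-zero scalars -/

section Weil

variable {V : Type u} [AddCommGroup V] [Module ℚ V] [Module.Finite ℚ V] [HodgeTensorFacts.{u, u}] {n : ℤ}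
  {H : HodgeStructure V n} {E : Type*} [Field E] [NumberField E] (A : EndAction H E)

omit [Module.Finite ℚ V] [HodgeTensorFacts.{u, u}] in
/-- The inclusion `x ↦ 1 ⊗ x` of a `ℚ`-space into its complexification is injective (`ℚ → ℂ` injective, flatness). [folklore] -/
private theorem one_tmul_injective {W : Type*} [AddCommGroup W] [Module ℚ W] :
    Function.Injective (fun x : W => (1 : ℂ) ⊗ₜ[ℚ] x) := by
  have h := Module.Flat.rTensor_preserves_injective_linearMap (M := W) (Algebra.linearMap ℚ ℂ)
    (algebraMap ℚ ℂ).injective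
  intro v w hvw
  have : (Algebra.linearMap ℚ ℂ).rTensor W ((TensorProduct.lid ℚ W).symm v) =
      (Algebra.linearMap ℚ ℂ).rTensor W ((TensorProduct.lid ℚ W).symm w) := by
    simpa using hvw
  exact (TensorProduct.lid ℚ W).symm.injective (h this)

omit [Module.Finite ℚ V] [HodgeTensorFacts.{u, u}] in
/-- **`D_X` is injective on Weil's `⋀ᵈ_E V`** when, for every embedding `σ`, the Weil line `⋀ᵈ V_{ℂ,σ}` lies in an eigenspace of `D_{X_ℂ}` with
NON-ZERO eigenvalue `c σ`: `(⋀ᵈ_E V) ⊗ ℂ = ⊕_σ ⋀ᵈ V_{ℂ,σ}` (`map_baseChange_weilPower`) lies in `⊕_{μ ≠ 0} ker(D_{X_ℂ} − μ)`, which meets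
`ker D_{X_ℂ}` trivially (independence of eigenspaces), and `θ₀ (1 ⊗ D_X w) = D_{X_ℂ} θ₀(1 ⊗ w)` (`baseChange_derivationExteriorPower`).
[cite: Deligne1982HodgeCycles, §4 Prop. 4.4] [cite: MoonenZarhin1999LowDim, Thm. 0.1 (4) and §3 (3.1)] -/
theorem eq_zero_of_mem_weilPower_of_derivationExteriorPower_eq_zero {d : ℕ} (X : Module.End ℚ V) (c : (E →+* ℂ) → ℂ)
    (hc : ∀ σ, c σ ≠ 0)
    (heig : ∀ σ : E →+* ℂ, LinearMap.range (exteriorPower.map d (⨅ e, Module.End.eigenspace ((A.ι e).baseChange ℂ) (σ e)).subtype) ≤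
      Module.End.eigenspace (derivationExteriorPower (X.baseChange ℂ) d) (c σ))
    {w : ⋀[ℚ]^d V} (hw : w ∈ A.weilPower d) (hDw : derivationExteriorPower X d w = 0) : w = 0 := by
  set θ := exteriorPowerBaseChange V d with hθ
  set D := derivationExteriorPower (X.baseChange ℂ) d with hD
  -- `y = θ₀ (1 ⊗ w)` lies in `⊕_σ ⋀ᵈ V_{ℂ,σ}` and is killed by `D`
  have hy : θ ((1 : ℂ) ⊗ₜ[ℚ] w) ∈ ((A.weilPower d).baseChange ℂ).map θ :=
    Submodule.mem_map_of_mem (Submodule.tmul_mem_baseChange_of_mem (1 : ℂ) hw)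
  rw [A.map_baseChange_weilPower d] at hy
  have hDy : D (θ ((1 : ℂ) ⊗ₜ[ℚ] w)) = 0 := by
    rw [hD, hθ, ← baseChange_derivationExteriorPower ℚ ℂ V d (exteriorPowerBaseChange V d) exteriorPowerBaseChange_tmul_ιMulti X,
      LinearMap.baseChange_tmul, hDw, TensorProduct.tmul_zero, map_zero]
  -- `⊕_σ ⋀ᵈ V_{ℂ,σ} ≤ ⊕_{μ ≠ 0} ker(D − μ)`, disjoint from `ker D`
  have hle : (⨆ σ : E →+* ℂ, LinearMap.range (exteriorPower.map d
      (⨅ e, Module.End.eigenspace ((A.ι e).baseChange ℂ) (σ e)).subtype)) ≤ ⨆ μ ∈ {μ : ℂ | μ ≠ 0}, D.eigenspace μ :=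
    iSup_le fun σ => (heig σ).trans (le_biSup D.eigenspace (hc σ))
  have hdisj : Disjoint (D.eigenspace 0) (⨆ μ ∈ {μ : ℂ | μ ≠ 0}, D.eigenspace μ) :=
    (Module.End.eigenspaces_iSupIndep D).disjoint_biSup (by simp)
  have hker : θ ((1 : ℂ) ⊗ₜ[ℚ] w) ∈ D.eigenspace 0 := by
    rw [Module.End.mem_eigenspace_iff, hDy, zero_smul]
  have h0 : θ ((1 : ℂ) ⊗ₜ[ℚ] w) = 0 := by
    have h := hdisj.le_bot (Submodule.mem_inf.2 ⟨hker, hle hy⟩)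
    rwa [Submodule.mem_bot] at h
  have h1 : (1 : ℂ) ⊗ₜ[ℚ] w = 0 :=
    (exteriorPowerBaseChange_bijective V d).1 (by rw [← hθ, h0, map_zero])
  exact one_tmul_injective (show (1 : ℂ) ⊗ₜ[ℚ] w = (1 : ℂ) ⊗ₜ[ℚ] (0 : ⋀[ℚ]^d V) by rw [h1, TensorProduct.tmul_zero])

end Weil

/-! ## §3 Weil type: such an `X` is not in `𝔥(H)` -/

section WeilType

variable {V : Type u} [AddCommGroup V] [Module ℚ V] [Module.Finite ℚ V] [HodgeTensorFacts.{u, u}]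
  {H : HodgeStructure V 1} {E : Type*} [Field E] [NumberField E] (A : EndAction H E)

/-- **Weil classes cut down `𝔥(H)`.**  Let `H` be effective of weight `1` with an action of a quadratic number field `E` OF WEIL TYPE
(`2 n_σ = d = dim_ℂ V_{ℂ,σ}` for every `σ`, `d > 0`), and let the rational operator `X` have derivation `D_{X_ℂ}` scaling each Weil line
`⋀ᵈ V_{ℂ,σ}` by a NON-ZERO `c σ`.  Then `X ∉ 𝔥(H)`: Weil's plane `⋀ᵈ_E V` (dimension `2·C(d,d) = 2`, `finrank_weilPower'`) consists of
Hodge classes of `⋀ᵈ H` (`weilPower_le_hodgeClasses_of_forall_two_mul_multiplicity_eq`), `D_X` is injective on it (§2), while `𝔥(H)`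
kills every Hodge class of `⋀ᵈ H` (`derivationExteriorPower_apply_eq_zero_of_mem_hodgeLie`).  Moonen–Zarhin's mechanism «the Weil classes
are really needed»: an operator of `𝔥(H₁) × 𝔥(H₂)` moving them is not in `𝔥(H₁ ⊕ H₂)`.
[cite: MoonenZarhin1999LowDim, Thm. 0.1 (4) and §3 (3.1)] [cite: Deligne1982HodgeCycles, §4 Prop. 4.4] [cite: vanGeemen1994HodgeAV, 4.9–4.10] -/
theorem not_mem_hodgeLie_of_weilType_of_derivation_eigenvalues (heff : H.IsEffective)
    (hE2 : Module.finrank ℚ E = 2) {d : ℕ} (hd : 0 < d)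
    (hdim : ∀ σ : E →+* ℂ, Module.finrank ℂ ↥(⨅ e, Module.End.eigenspace ((A.ι e).baseChange ℂ) (σ e)) = d)
    (hW : ∀ σ : E →+* ℂ, 2 * A.multiplicity σ = d) (X : Module.End ℚ V) (c : (E →+* ℂ) → ℂ) (hc : ∀ σ, c σ ≠ 0)
    (heig : ∀ σ : E →+* ℂ, LinearMap.range (exteriorPower.map d (⨅ e, Module.End.eigenspace ((A.ι e).baseChange ℂ) (σ e)).subtype) ≤
      Module.End.eigenspace (derivationExteriorPower (X.baseChange ℂ) d) (c σ)) :
    X ∉ H.hodgeLie := by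
  obtain ⟨σ₀⟩ := (inferInstance : Nonempty (E →+* ℂ))
  -- the Hodge type `(p, p)` of the Weil classes, `p + p = d`
  set p : ℤ := (A.multiplicity σ₀ : ℤ) with hpdef
  have hp' : p + p = (d : ℤ) := by
    have h := hW σ₀
    omega
  have hp : p + p = (d : ℤ) * 1 := by rw [mul_one]; exact hp'
  have hle : A.weilPower d ≤ (H.exteriorPower d).hodgeClasses p :=
    A.weilPower_le_hodgeClasses_of_forall_two_mul_multiplicity_eq heff hd.ne' hdim hp' hW
  -- a non-zero Weil class
  have hV : Module.finrank ℚ V / Module.finrank ℚ E = d := by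
    rw [hE2, ← A.finrank_iInf_eigenspace_of_finrank_eq_two hE2 σ₀, hdim σ₀]
  have hfin : Module.finrank ℚ (A.weilPower d) = 2 := by
    rw [A.finrank_weilPower' d hd.ne', hV, Nat.choose_self, hE2]
  obtain ⟨w, hw, hw0⟩ : ∃ w ∈ A.weilPower d, w ≠ 0 := by
    by_contra h
    push Not at h
    have hbot : A.weilPower d = ⊥ := (Submodule.eq_bot_iff _).2 h
    rw [hbot, finrank_bot] at hfin
    exact absurd hfin (by norm_num)
  have hDw : derivationExteriorPower X d w ≠ 0 := fun h0 =>
    hw0 (eq_zero_of_mem_weilPower_of_derivationExteriorPower_eq_zero A X c hc heig hw h0)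
  exact not_mem_hodgeLie_of_derivationExteriorPower_apply_ne_zero H hp (hle hw) hDw

end WeilType

end HodgeStructure

end Literature.AlgebraicGeometry.Motives

end
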